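import Summits.CriticalPhenomena.PercolationContinuityZ3.Theorems.PercNearOneGluingNoHeavyLowerTailIncStarSlackEdgeInduction
import Summits.CriticalPhenomena.PercolationContinuityZ3.Theorems.PercNearOneGluingNoHeavyLowerTailIncStarSlackEdgeBase
import HarnessLib

/-!
# "(MQ-Bern) ⟹ increasing star": the inner edge induction with its base case discharged

Support file for the Sahi programme (`--supports stmt-CriticalPhenomena-4575`, prover prim-sahi-p2 gen 16).  No definitions, no named
facts, no sorries; standard axioms.  Assembles `IncStar.incStar_nonneg_of_slackEdgeBernstein` (file `…IncStarSlackEdgeInduction`: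
`(MQ-Bern)` + base case ⟹ `(MQ)` ⟹ star) with `IncStar.rootStarMixture_base` (file `…IncStarSlackEdgeBase`: the base case holds): the
increasing star `E₃({s↔b},{s↔c},{s↔y}) ≥ 0` on every finite weighted graph follows from the SINGLE hypothesis `(MQ-Bern)` — at every
non-loop pair missing the root, the `π`-mixture over the pinned root stars of `polar₁` is at most `polar₁` (both orders), i.e. both mixed
Bernstein coefficients of the root-star mixture slack along the pair are nonnegative.  Memo
`run/shared/lean/prim/prim-sahi/FROM-prim-sahi-p2-gen16-CURVATURE-MAP-SHARP-FORM.md` §(D), `prim-sahi-p2/PROOF-E3.md` §26k.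
-/

noncomputable section

namespace Summit.CriticalPhenomena.PercolationContinuityZ3.Theorems

namespace IncStar

open Finset MeasureTheory Literature.Probability.Percolation Literature.Probability.LatticeModels EdgeInduction
open scoped Classical

variable {n : ℕ}

/-- **"(MQ-Bern) ⟹ increasing star"**, with the base case discharged: if at every non-loop pair missing the root both mixed slack
coefficients of the root-star mixture are nonnegative (hypothesis `(MQ-Bern)` of `rootStarMixture_of_slackEdgeBernstein`), then
`E₃({s↔b},{s↔c},{s↔y}) ≥ 0` for every weight on `Fin n`, every root and all targets. [this work] -/
theorem incStar_nonneg_of_slackEdgeBernstein'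
    (hBern : ∀ (w : Sym2 (Fin n) → unitInterval) (s b c y : Fin n) (e : Sym2 (Fin n)), ¬ e.IsDiag → s ∉ e →
      (∑ O ∈ ((fracEdges w).filter fun f => ¬ f.IsDiag ∧ s ∈ f).powerset,
          (∏ f ∈ O, (w f : ℝ)) * (∏ f ∈ ((fracEdges w).filter fun f => ¬ f.IsDiag ∧ s ∈ f) \ O, (1 - (w f : ℝ))) *
            polar₁ (prodBernoulli (Function.update (fun f => if f ∈ O then (1 : unitInterval)
                else if f ∈ ((fracEdges w).filter fun f => ¬ f.IsDiag ∧ s ∈ f) then 0 else w f) e 0))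
              (prodBernoulli (Function.update (fun f => if f ∈ O then (1 : unitInterval)
                else if f ∈ ((fracEdges w).filter fun f => ¬ f.IsDiag ∧ s ∈ f) then 0 else w f) e 1))
              (openConn s b) (openConn s c) (openConn s y) ≤
        polar₁ (prodBernoulli (Function.update w e 0)) (prodBernoulli (Function.update w e 1))
          (openConn s b) (openConn s c) (openConn s y)) ∧
      (∑ O ∈ ((fracEdges w).filter fun f => ¬ f.IsDiag ∧ s ∈ f).powerset,
          (∏ f ∈ O, (w f : ℝ)) * (∏ f ∈ ((fracEdges w).filter fun f => ¬ f.IsDiag ∧ s ∈ f) \ O, (1 - (w f : ℝ))) *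
            polar₁ (prodBernoulli (Function.update (fun f => if f ∈ O then (1 : unitInterval)
                else if f ∈ ((fracEdges w).filter fun f => ¬ f.IsDiag ∧ s ∈ f) then 0 else w f) e 1))
              (prodBernoulli (Function.update (fun f => if f ∈ O then (1 : unitInterval)
                else if f ∈ ((fracEdges w).filter fun f => ¬ f.IsDiag ∧ s ∈ f) then 0 else w f) e 0))
              (openConn s b) (openConn s c) (openConn s y) ≤
        polar₁ (prodBernoulli (Function.update w e 1)) (prodBernoulli (Function.update w e 0))
          (openConn s b) (openConn s c) (openConn s y))) :
    ∀ (w : Sym2 (Fin n) → unitInterval) (s b c y : Fin n),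
      0 ≤ sahiE3 (prodBernoulli w) (openConn s b) (openConn s c) (openConn s y) :=
  incStar_nonneg_of_slackEdgeBernstein hBern fun w s b c y hdet => rootStarMixture_base w s b c y hdet

/-! ## Addendum (prim-sahi-p2 gen 18, 2026-08-23): STATUS OF THE HYPOTHESIS — `(MQ-Bern)` IS FALSE

The single hypothesis `hBern` (`(MQ-Bern)`) of `incStar_nonneg_of_slackEdgeBernstein'` is FALSE (prim-sahi-p2 gen 17, census §62, referee R613;
see the addenda of `…IncStarSlackEdgeInduction` and `…IncStarRootStarMixture`): witness A (6 vertices, exact rationals): root `s = 0`, targets `1, 2, 3`, further vertices `o = 4`, `x = 5`; pair weights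
`(s,o) = 1 − 10⁻¹¹`, `(s,2) = 1/2`, `(1,2) = 1/2`, `(o,2) = 1619/1620`, `(2,3) = 3/4`, `(o,x) = 1/4`, `(x,2) = 3/4`, `(x,3) = 1/4` (all other pairs
weight `0`).  There the root-star mixture slack is
`Φ = T(w; s) − Σ_O π(O) T(w^O; s) = −2233727963462351710991103745506326371 / 563585608581120000000000000000000000000000000000 ≈ −3.96·10⁻¹²`
(`T(w; s) ≈ 9.90·10⁻⁵ > 0`; with `(s,o) = 1` exactly, `Φ = −1681/281792804290560`).  Confirmed digit for digit by six independent exact engines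
(prim-sahi-p2 gen 17 `gen17/py/witness_exact.py`; census §62 + addenda: `bern3.py`, `comb/w73/mqn.py`, `comb/w70/mq.py`; lead gen 117 `mqn_graph.py`;
referee R613 `ref613_mq.py`).  MECHANISM (memo FROM-prim-sahi-p2-gen17-MQ-REFUTED-HITTING-C3.md §1.2, `prim-sahi-p2/PROOF-E3.md` §27a–c): give the
root one near-sure pair `(s,r)` and move a sub-star `P` of `r` to `s`; as `w(s,r) → 1` the `(MQ)` instance at `s` degenerates to 'revealing only the
sub-star `P` at `r`', and for `|P| = 1` this is the single-root-pair chord inequality, refuted on the bypass family `W2` (ttrl) — witness B =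
`W2(3)` hub–target with `p(r,h) = 9/10` plus the new root: `Φ = −6.666·10⁻¹³` exactly.  Census §62 gives the closed form
`Φ(ε,p) = λ·ε(1−ε)(1−p)²(1−τ)·[L + (1−τ)·ΔP_c·(1−p)(1+ε)]` with the x-hub defect `L = −41/65536`, and witnesses with all weights in `{1/4, 1/2, 3/4}`
(two-path bundles, 35 vertices).  The defect is tiny (`|Φ|/T ≤ 10⁻⁷`) but its support is an open set of ordinary sparse weighted graphs, so no
weight-bounded / simple-graph / distinct-target restriction of the hypothesis survives.
On witness A, `B₁` of the slack along the non-root pair `(o,2)` equals `−2.09·10⁻⁵`.  The theorem stays a valid conditional schema; the base case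
`IncStar.rootStarMixture_base` / `incStar_nonneg_of_nonRootDet` of `…IncStarSlackEdgeBase` ('star of a star of blocks') is an unconditional theorem
and is reused by `…IncStarDualRevelation`.  Route status for `stmt-CriticalPhenomena-4575`: CLOSED.
-/

end IncStar

end Summit.CriticalPhenomena.PercolationContinuityZ3.Theorems
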